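import Literature.MathematicalPhysics.QuantumFieldTheory.Balaban1983to89.Node00.LinearisedAveragingFlat
import Literature.MathematicalPhysics.QuantumFieldTheory.Balaban1983to89.B5Eq117TorusCarriers
import Literature.MathematicalPhysics.QuantumFieldTheory.Balaban1983to89.Node00.OpsYSectELetters
import Summits.QuantumFields.YangMills.Theorems.UnitScaleTiltProp7CombGaugeIter
import Summits.QuantumFields.YangMills.Theorems.BalabanUVNodesK0Stub1OneLevelConstraintDictionary
import Summits.QuantumFields.YangMills.Theorems.BalabanUVNodesN12FlatChartDerivIterLin
import HarnessLib

/-!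
# K0⁷ STUB 1 (`stub_prop8StepCoP13`), sub-target S4a — **THE FLAT AVERAGING DICTIONARY**: the record's linearised `k`-fold (0.4) averaging at `U₀ = 1`
# (dag-n07-w1's `Q_k(1) = Node00.dIterL k 1` ∕ `qLin k 1`, D4-flat) versus PRINT's straight `k`-fold average `L^k·Q_k` ([B5] (1.18) `LatticeFieldCalculus.bondAvgIter`
# = lit-balaban's multi-level `QE D` ∕ this seat's `Q_V` read on the constrained bonds): **EQUAL MODULO THE COARSE PURE GAUGE `∂Λ_k` of the hierarchical comb functional,
# and the two KERNELS — n07-w1∕n07-w2∕dag-n10-w1's chart kernel `Q_k(1)X = 0` and this seat's (128) test class `Q_VX = 0` — are in linear bijection by skew-Hermitian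
# (𝔰𝔲(N)-valued) linearised gauge transformations**

Cell `pub-ymgap`, width seat `pub-ymgap-k0-s1-w1` g3 (CLAIM-1 ∕ INTENT-1; trigger (t1′) of HANDOFF § g2: n07-w1's 5b `Node00/LinearisedAveragingFlat` p597896 + hand-off l.27402
«the dictionary `Node00.dIterL k 1` ↔ `QE`∕`bondAvgIter` is NOT in 5b … yours to quote»).  `--kind proof --supports stmt-QuantumFields-20541 --as helper`; count-neutral.
[15] = [Balaban1985Variational]; [B5] = [Balaban1984PropagatorsI]; [B6] = [Balaban1984PropagatorsII]; [B7] = [Balaban1985Averaging].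

WHY.  [15] (44)∕(47) p. 285 writes the linearised `k`-fold constraint of Sects. C–F as PRINT's straight average «L^jηQ_jA» of [B5]∕[B6], and this seat's S4a files (p595460 (127)⟹(158),
p596821 (165)-entry, p598323) take the tangent space as `ker Q_V`, `Q_V` the componentwise extension of lit-balaban's `QE D` ([B6] (2.20)).  The record's averaging is the symmetric
(0.4) average, whose linearisation at `1` dag-n07-w1 identified with UST's `linAvg` recursion (5b ★★★ `dIterL_one_apply_of_skew`, `qLin_one_eq_family`) — the operator of
n07-w2's multi-scale chart kernel (5c `fderiv_msChart_apply_eq_zero_iff`, dag-n10-w1's `N12FlatChartDerivIterLin.fderiv_msChart_one_apply_eq_iterLin`).  The two differ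
(g2's caution «radial-contour terms»; n07-w3's LOCATED-DICT-AVG): by UST `BlockAveragingEMLLinearised.linAvg_eq_bondAvg_sub_grad_combMean` one level is `Q₁Y = L·QY − ∂λ̄_Y`
(`λ̄` = `combMean`, the linearisation of [B7]'s double-bar gauge `v` (62)–(63)), iterated by the route UnitScaleTilt at generic `P` (`ChartHInv.linFamily_eq_sub_comb`:
`Q^{(k)} = L^k·Q_k − ∂Λ_k`; `Prop7CombGauge.exists_combGauge_iterLin`).  THIS FILE reads those kernel-checked generic identities ON THE RECORD's OPERATOR `dIterL k 1` and in this
seat's `Q_V` letters, keeping every gauge function inside the Lie algebra (skew ∕ 𝔰𝔲(N)-valued), which the generic comb gauge does not record.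

WHAT IS PROVED (sorry-free; no definition; axioms standard; `M = M_N(ℂ)`, «skew» = `Y_b⋆ = −Y_b`; `Λ` = any family with UST `ChartHInv`'s recursion `Λ₀ = 0`,
`Λ_{i+1}(Y) = L^i·λ̄(Q_iY) + Λ_i(Y)∘emb` — inhabited by `ChartHInv.exists_combFamily`).
* §0 letters: `star_bondAvgIter(_of_skew)`, `star_combMean_of_skew`, `bondAvgIter_mem_lieSU`, `combMean_mem_lieSU`, ★ `combFamily_skew` ∕ `combFamily_mem_lieSU` (the comb
  functional of a skew ∕ 𝔰𝔲(N)-valued field is skew ∕ 𝔰𝔲(N)-valued).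
* §1 ★ `QV_apply_eq_bondAvgIter` — for EVERY nested family `D`: `(Q_VA)(j,c) = (Q_jA)(c)` (p598323 §1 was the one-level member); `QV_eq_zero_iff`, `QV_twoScale_eq_zero_iff` — stated
  with the `DecidableEq` instance on bonds as a unifiable implicit (the NODE 00 chain and this seat's g2 files elaborate `Pi.single` with different instances).
* §2 ★★ `dIterL_one_eq_sub_comb` — **`(Q_k(1)Y)(c) = L^k·(Q_kY)(c) − (Λ_k(Y)(c₊) − Λ_k(Y)(c₋))` on skew `Y`** (5b ∘ UST); `qLin_one_eq_sub_comb` (Lie-algebra fields);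
  ★ `dIterL_one_grad` (`Q_k(1)(∂φ) = ∂(φ∘embIter k)`: pure gauges ↦ coarse pure gauges by RESTRICTION TO THE CENTRES, [B7] (11)); ★ `curl_dIterL_one` (print's (44)
  «Q_k(1) = L^kQ_k» holds EXACTLY on plaquette variables).
* §3 ★★★ `exists_gauge_bondAvgIter_eq_zero_of_dIterL_one_eq_zero` — `Q_k(1)Y = 0`, `1 ≤ k ≤ m + K` ⟹ a SKEW gauge function `λ` vanishing at the `k`-centres (the Lie algebra
  of print's group (4)) with `Q_k(Y + ∂λ) = 0` and `Q_k(1)(Y + ∂λ) = 0`, `λ` 𝔰𝔲(N)-valued if `Y` is (the far-corner point masses of `−L^{kd}Λ_k(Y)`: UST's comb gauge re-assembled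
  on the skew comb functional); ★★★ `exists_gauge_dIterL_one_eq_zero_of_bondAvgIter_eq_zero` — `Q_kZ = 0`, `k ≤ m + K` ⟹ the block-constant skew lift `ν = Λ_k(Z)∘B^k` gives
  `Q_k(1)(Z + ∂ν) = 0`; ★★ `annihilates_ker_dIterL_one_iff` — an additive functional killing skew pure gauges annihilates one skew kernel iff it annihilates the other.
Companion (same INTENT): `…K0Stub1FlatAveragingDictionaryAtRecord` — the Lie-algebra-field editions (`qLin k 1`), NODE 00's fine torus `Site (F.P K) 0`, and the (128) letter
`Q_V (twoScale k _ ∅)` of p593232∕p593935∕p595460∕p596821∕p598323.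

HONEST SCOPE.  Lattice calculus ∕ bookkeeping at the FLAT background `U₀ = 1` only; the identities are the route UnitScaleTilt's generic-`P` theorems and n07-w1's D4-flat
junction, read on NODE 00's operator and this seat's letters — nothing of Bałaban's analysis asserted.  NOT here: curved backgrounds (`Q_k(U₀)`, the `R(V₀(Γ))` conjugations of
[B7] (121)–(124)); a SINGLE gauge function serving all levels of a multi-level family `D` at once (the statements are level-wise ∕ one-level); the (154)–(156) data side of the
dictionary (S3's); which reading the chart (47) ∕ the (127)–(128) criticality should carry at the record is S2's decision (the two readings are gauge-equivalent at the
linear flat level by §3, not asserted equivalent for the nonlinear problem).  `stub_prop8StepCoP13` ∕ K0⁷ NOT closed; N07 NOT discharged; counts unmoved (28∕28 · 5∕27); one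
finite 𝕋⁴ programme at fixed ε — R4 closes the conditional finite-𝕋⁴ rung `BalabanLadder.UV` only, never the summit; the YM mass gap (Clay) is NOT proved by any of this;
nothing continuum ∕ ℝ⁴ ∕ OS.  No `sorry`, no `def`, no `instance`, no `notation`.

References: [15] (4) p.278, (44)–(47) p.285, (156)–(157) p.302; [B5] (1.11)–(1.13) p.19, (1.18)–(1.20) p.20; [B6] (2.20) p.226, (2.90) p.239; [B7] (11) p.18, (62) p.28,
(124)–(125) p.36; [Balaban1987RG1] (0.1)–(0.4) pp.251–253.
-/

set_option autoImplicit false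
noncomputable section
open scoped BigOperators Matrix

namespace Summit.QuantumFields.YangMills.Theorems.K0Stub1FlatAveragingDictionary

open Literature.MathematicalPhysics.QuantumFieldTheory.Balaban1983to89
open Literature.MathematicalPhysics.QuantumFieldTheory.Balaban1983to89.T4Continuum (T4Family)
open LatticeFieldCalculus (bondAvgIter siteAvgIter grad curl)
open BlockAveragingEMLLinearised (linAvg walkSum combMean combMean_def)
open B5Eq118OneStroke (iterBlockOf iterBlockOf_zero iterBlockOf_succ)
open B15DeterminingSets (embIter)
open T4AdjointCovarianceUnitary (lieSU mem_lieSU_iff)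
open Node00 (SU dIterL qLin dIterL_one_apply_of_skew qLin_one_eq_family star_walkSum_of_skew)
open Summit.QuantumFields.YangMills.Theorems.ChartHInv (linFamily_eq_sub_comb linFamily_grad linFamily_add bondAvgIter_comp_apply
  bondAvgIter_kernel_apply bondAvgIter_const_smul exists_linFamily exists_combFamily)
open Summit.QuantumFields.YangMills.Theorems.Prop7CombGauge (siteAvgIter_cornerMass embIter_ne_farCorner)
open Summit.QuantumFields.YangMills.BalabanUVNodes.N12FlatChartDerivIterLin (walkSum_mem_lieSU)
open Literature.MathematicalPhysics.QuantumFieldTheory.BalabanImbrieJaffe1984to88.BIJ85AxialPropagator411 (bondAvgIter_add)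

variable {P : Params} {N : ℕ}

/-! ## §0  Letters: the straight averages, the comb means and the hierarchical comb functional preserve skew-Hermitian ∕ 𝔰𝔲(N)-valued fields -/

/-- `Q_k` commutes with the conjugate transpose: `(Q_kY)(c)⋆ = (Q_k Y⋆)(c)` (real-linear coefficients). [cite: Balaban1984PropagatorsI, (1.18) p.20] -/
theorem star_bondAvgIter (k : ℕ) (Y : PBond P 0 → Matrix (Fin N) (Fin N) ℂ) (c : PBond P k) :
    star (bondAvgIter k Y c) = bondAvgIter k (fun b => star (Y b)) c := by
  have h := bondAvgIter_comp_apply (((starL' ℝ : Matrix (Fin N) (Fin N) ℂ ≃L[ℝ] Matrix (Fin N) (Fin N) ℂ) :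
    Matrix (Fin N) (Fin N) ℂ →L[ℝ] Matrix (Fin N) (Fin N) ℂ) : Matrix (Fin N) (Fin N) ℂ →ₗ[ℝ] Matrix (Fin N) (Fin N) ℂ) k Y c
  simpa only [ContinuousLinearMap.coe_coe, ContinuousLinearEquiv.coe_coe, starL'_apply] using h.symm

/-- `Q_k` of a skew-Hermitian field is skew-Hermitian. [cite: Balaban1984PropagatorsI, (1.18) p.20] -/
theorem star_bondAvgIter_of_skew (k : ℕ) {Y : PBond P 0 → Matrix (Fin N) (Fin N) ℂ} (hY : ∀ b, star (Y b) = -Y b) (c : PBond P k) :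
    star (bondAvgIter k Y c) = -bondAvgIter k Y c := by
  rw [star_bondAvgIter, show (fun b => star (Y b)) = fun b => (-1 : ℂ) • Y b from funext fun b => by rw [hY, neg_one_smul],
    bondAvgIter_const_smul, neg_one_smul]

/-- The comb mean `λ̄_Y` ([Balaban1985Averaging] (62)) of a skew-Hermitian field is skew-Hermitian (real mean of skew signed sums; n07-w1's `star_linAvg_of_skew` pattern,
the skew twin of dag-n18-w3's `YMDAG.N18.AvgPotential.star_combMean_of_selfAdjoint`).
[cite: Balaban1985Averaging, (62) p.28] -/
theorem star_combMean_of_skew {j : ℕ} {Y : PBond P j → Matrix (Fin N) (Fin N) ℂ} (hY : ∀ b, star (Y b) = -Y b) (y : Site P (j + 1)) :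
    star (combMean Y y) = -combMean Y y := by
  rw [combMean_def, star_smul, star_sum, star_inv₀, star_natCast, ← smul_neg, ← Finset.sum_neg_distrib]
  congr 1
  exact Finset.sum_congr rfl fun i _ => star_walkSum_of_skew hY _

/-- `Q_k` of an `𝔰𝔲(N)`-valued field is `𝔰𝔲(N)`-valued (`Q_k` on the real module `𝔰𝔲(N)` itself, read back in `M_N(ℂ)`). [cite: Balaban1984PropagatorsI, (1.18) p.20] -/
theorem bondAvgIter_mem_lieSU (k : ℕ) {Y : PBond P 0 → Matrix (Fin N) (Fin N) ℂ} (hY : ∀ b, Y b ∈ lieSU (Fin N)) (c : PBond P k) :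
    bondAvgIter k Y c ∈ lieSU (Fin N) := by
  have h := bondAvgIter_comp_apply (lieSU (Fin N)).subtype k (fun b => (⟨Y b, hY b⟩ : lieSU (Fin N))) c
  simp only [Submodule.subtype_apply] at h
  rw [h]
  exact (bondAvgIter k (fun b => (⟨Y b, hY b⟩ : lieSU (Fin N))) c).2

/-- The comb mean of an `𝔰𝔲(N)`-valued field is `𝔰𝔲(N)`-valued. [cite: Balaban1985Averaging, (62) p.28] -/
theorem combMean_mem_lieSU {j : ℕ} {Y : PBond P j → Matrix (Fin N) (Fin N) ℂ} (hY : ∀ b, Y b ∈ lieSU (Fin N)) (y : Site P (j + 1)) :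
    combMean Y y ∈ lieSU (Fin N) := by
  rw [combMean_def, ← Complex.ofReal_natCast, ← Complex.ofReal_inv, Complex.coe_smul]
  exact Submodule.smul_mem _ _ (Submodule.sum_mem _ fun i _ => walkSum_mem_lieSU hY _)

section Families

variable (Λ : (i : ℕ) → (PBond P 0 → Matrix (Fin N) (Fin N) ℂ) → Site P i → Matrix (Fin N) (Fin N) ℂ)
  (hΛ0 : ∀ Y y, Λ 0 Y y = 0)
  (hΛs : ∀ (i : ℕ) (Y : PBond P 0 → Matrix (Fin N) (Fin N) ℂ) (y : Site P (i + 1)),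
    Λ (i + 1) Y y = (P.L ^ i : ℕ) • combMean (bondAvgIter i Y) y + Λ i Y (emb y))

include hΛ0 hΛs in
/-- **THE HIERARCHICAL COMB FUNCTIONAL `Λ_k` (UST `ChartHInv`'s recursion family: `Λ₀ = 0`, `Λ_{i+1}(Y) = L^i·λ̄(Q_iY) + Λ_i(Y)∘emb`) OF A SKEW-HERMITIAN FIELD
IS SKEW-HERMITIAN.** [cite: Balaban1985Averaging, (62) p.28; Balaban1984PropagatorsI, (1.18) p.20] -/
theorem combFamily_skew {Y : PBond P 0 → Matrix (Fin N) (Fin N) ℂ} (hY : ∀ b, star (Y b) = -Y b) :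
    ∀ (k : ℕ) (y : Site P k), star (Λ k Y y) = -Λ k Y y
  | 0, y => by rw [hΛ0, star_zero, neg_zero]
  | k + 1, y => by
    rw [hΛs, star_add, star_nsmul, star_combMean_of_skew (star_bondAvgIter_of_skew k hY), combFamily_skew hY k (emb y), neg_add, smul_neg]

include hΛ0 hΛs in
/-- The hierarchical comb functional of an `𝔰𝔲(N)`-valued field is `𝔰𝔲(N)`-valued. [cite: Balaban1985Averaging, (62) p.28] -/
theorem combFamily_mem_lieSU {Y : PBond P 0 → Matrix (Fin N) (Fin N) ℂ} (hY : ∀ b, Y b ∈ lieSU (Fin N)) :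
    ∀ (k : ℕ) (y : Site P k), Λ k Y y ∈ lieSU (Fin N)
  | 0, y => by rw [hΛ0]; exact Submodule.zero_mem _
  | k + 1, y => by
    rw [hΛs]
    exact Submodule.add_mem _ (nsmul_mem (combMean_mem_lieSU (fun b => bondAvgIter_mem_lieSU k hY b) y) _)
      (combFamily_mem_lieSU hY k (emb y))

end Families

/-! ## §1  Lit-balaban's multi-level constraint `Q_V` (componentwise extension of `QE D`) IS `bondAvgIter` read on the constrained bonds — every nested family -/

open B6SectADomainsV1 (Domains)
open B6SectAOperatorsV1 (BondIdx QE QE_apply)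
open B6SectCTwoScaleV1 (twoScale)
open B6GOneLevelV1Bridge (bondIdxOfEmpty bondIdxOfEmpty_bijective)

/-- ★ **FOR EVERY NESTED FAMILY `D`**: the componentwise extension `Q_V` of [B6] (2.20)'s multi-level `QE D` (kernel formula of p595460) at the constrained index
`t = (j, c)` (`c` a bond of `Λ_j^{(j)}`) IS the straight `j`-fold average `(Q_j A)(c) = bondAvgIter j A c` of the matrix field itself (p598323 §1 was the one-level member).
[cite: Balaban1984PropagatorsII, (2.20) p.226; Balaban1984PropagatorsI, (1.18) p.20] -/
theorem QV_apply_eq_bondAvgIter (D : Domains P) {n : Type*} {instDE : DecidableEq (PBond P 0)}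
    {QV : (PBond P 0 → Matrix n n ℂ) →ₗ[ℂ] (BondIdx D → Matrix n n ℂ)}
    (hQV : ∀ (A : PBond P 0 → Matrix n n ℂ) (t : BondIdx D), QV A t = ∑ j, ((WithLp.ofLp (QE D (WithLp.toLp 2 (Pi.single j 1))) t : ℝ) : ℂ) • A j)
    (A : PBond P 0 → Matrix n n ℂ) (t : BondIdx D) : QV A t = bondAvgIter (t.1.1 : ℕ) A t.1.2 := by
  rw [hQV]
  have hA : (fun b : PBond P 0 => ∑ j, (Pi.single j (1 : ℝ) : PBond P 0 → ℝ) b • A j) = A := by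
    funext b
    rw [Finset.sum_eq_single b (fun j _ hj => by rw [Pi.single_eq_of_ne' hj, zero_smul]) (fun h => absurd (Finset.mem_univ b) h),
      Pi.single_eq_same, one_smul]
  conv_rhs => rw [← hA, bondAvgIter_kernel_apply]
  refine Finset.sum_congr rfl fun j _ => ?_
  rw [Complex.coe_smul, QE_apply, WithLp.ofLp_toLp]

/-- ★ `Q_VA = 0 ↔ (Q_jA)(c) = 0` at every constrained `(j, c)` — the tangent-space hypothesis «`Q_Vδ = 0`» of this seat's (127)∕(128)∕(158)∕(165) files, read as the
vanishing of the STRAIGHT averages on the bonds of the family. [cite: Balaban1984PropagatorsII, (2.20) p.226; Balaban1985Variational, (156)–(157) p.302] -/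
theorem QV_eq_zero_iff (D : Domains P) {n : Type*} {instDE : DecidableEq (PBond P 0)}
    {QV : (PBond P 0 → Matrix n n ℂ) →ₗ[ℂ] (BondIdx D → Matrix n n ℂ)}
    (hQV : ∀ (A : PBond P 0 → Matrix n n ℂ) (t : BondIdx D), QV A t = ∑ j, ((WithLp.ofLp (QE D (WithLp.toLp 2 (Pi.single j 1))) t : ℝ) : ℂ) • A j)
    (A : PBond P 0 → Matrix n n ℂ) : QV A = 0 ↔ ∀ t : BondIdx D, bondAvgIter (t.1.1 : ℕ) A t.1.2 = 0 := by
  constructor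
  · intro h t; rw [← QV_apply_eq_bondAvgIter D hQV A t, h, Pi.zero_apply]
  · intro h; funext t; rw [QV_apply_eq_bondAvgIter D hQV A t, h t, Pi.zero_apply]

/-- ★ The ONE-LEVEL member (`twoScale k _ ∅`: constraints = all level-`k` bonds, [B6] (2.90) at `Λ′ = ∅`): `Q_VA = 0 ↔ ∀ c, (Q_kA)(c) = 0` — p598323's
`QV_twoScale_empty_eq_zero_iff`, re-derived from the every-family statement so that it is agnostic of the `DecidableEq` instance on bonds (the NODE 00 chain and this
seat's g2 files carry different ones). [cite: Balaban1984PropagatorsII, (2.20) p.226, (2.90) p.239] -/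
theorem QV_twoScale_eq_zero_iff {k : ℕ} (hk1 : k + 1 ≤ P.m + P.K) {n : Type*} {instDE : DecidableEq (PBond P 0)}
    {QV : (PBond P 0 → Matrix n n ℂ) →ₗ[ℂ] (BondIdx (twoScale k hk1 (∅ : Finset (Site P (k + 1)))) → Matrix n n ℂ)}
    (hQV : ∀ (A : PBond P 0 → Matrix n n ℂ) (t : BondIdx (twoScale k hk1 (∅ : Finset (Site P (k + 1))))),
      QV A t = ∑ j, ((WithLp.ofLp (QE (twoScale k hk1 ∅) (WithLp.toLp 2 (Pi.single j 1))) t : ℝ) : ℂ) • A j)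
    (A : PBond P 0 → Matrix n n ℂ) : QV A = 0 ↔ ∀ c : PBond P k, bondAvgIter k A c = 0 := by
  rw [QV_eq_zero_iff (twoScale k hk1 ∅) hQV A]
  constructor
  · intro h c; exact h (bondIdxOfEmpty hk1 c)
  · intro h t
    obtain ⟨c, rfl⟩ := (bondIdxOfEmpty_bijective hk1).2 t
    exact h c

/-! ## §2  THE RECORD's OPERATOR: `Q_k(1) = dIterL k 1` (n07-w1) IS `L^k·Q_k − ∂Λ_k` ON SKEW-HERMITIAN FIELDS; pure gauges; plaquette variables -/

section Record

variable [NeZero N]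
variable (Λ : (i : ℕ) → (PBond P 0 → Matrix (Fin N) (Fin N) ℂ) → Site P i → Matrix (Fin N) (Fin N) ℂ)
  (hΛ0 : ∀ Y y, Λ 0 Y y = 0)
  (hΛs : ∀ (i : ℕ) (Y : PBond P 0 → Matrix (Fin N) (Fin N) ℂ) (y : Site P (i + 1)),
    Λ (i + 1) Y y = (P.L ^ i : ℕ) • combMean (bondAvgIter i Y) y + Λ i Y (emb y))

include hΛ0 hΛs in
/-- ★★ **THE FLAT AVERAGING DICTIONARY.**  The record's linearised `k`-fold (0.4) averaging at `U₀ = 1`, n07-w1's `Q_k(1) = dIterL k 1` (the Fréchet derivative of 35b's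
matrix extension `iterM k` at `1`), equals on every SKEW-HERMITIAN fine field `Y` PRINT's straight `k`-fold average `L^k·Q_k` ([B5] (1.18), `bondAvgIter`; = lit-balaban's
`QE`∕`Q_V` on the constrained bonds, §1) MINUS THE COARSE PURE GAUGE `∂Λ_k(Y)` of the hierarchical comb functional:
`(Q_k(1)Y)(c) = L^k·(Q_kY)(c) − (Λ_k(Y)(c₊) − Λ_k(Y)(c₋))`.  (n07-w1's `dIterL_one_apply_of_skew` ∘ UST `ChartHInv.linFamily_eq_sub_comb`; print's (44)∕(47)
«Q_k(1) = L^kηQ_k» holds EXACTLY modulo this gradient — the linearisation of [B7]'s double-bar normalisation (62)–(63).)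
[cite: Balaban1985Variational, (44)-(47) p.285; Balaban1985Averaging, (124)-(125) p.36, (62) p.28; Balaban1984PropagatorsI, (1.18) p.20] -/
theorem dIterL_one_eq_sub_comb {Y : PBond P 0 → Matrix (Fin N) (Fin N) ℂ} (hY : ∀ b, star (Y b) = -Y b) (k : ℕ) (c : PBond P k) :
    dIterL k (1 : PBond P 0 → Matrix (Fin N) (Fin N) ℂ) Y c = (P.L ^ k : ℕ) • bondAvgIter k Y c - (Λ k Y c.tgt - Λ k Y c.src) := by
  obtain ⟨Q, hQ0, hQs⟩ := exists_linFamily (P := P) (n := Fin N)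
  rw [(dIterL_one_apply_of_skew Q hQ0 hQs hY k).1]
  exact linFamily_eq_sub_comb Q hQ0 hQs Λ hΛ0 hΛs Y k c

include hΛ0 hΛs in
/-- ★ The same for print's left-trivialised reading on Lie-algebra fields: `(qLin k 1 X)(c) = L^k·(Q_k↑X)(c) − ∂Λ_k(↑X)(c)`.
[cite: Balaban1985Variational, (44)-(47) p.285; Balaban1984PropagatorsI, (1.18) p.20] -/
theorem qLin_one_eq_sub_comb (k : ℕ) (X : PBond P 0 → lieSU (Fin N)) (c : PBond P k) :
    qLin k (1 : GaugeField P 0 (SU N)) X c =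
      (P.L ^ k : ℕ) • bondAvgIter k (fun b => (X b : Matrix (Fin N) (Fin N) ℂ)) c -
        (Λ k (fun b => (X b : Matrix (Fin N) (Fin N) ℂ)) c.tgt - Λ k (fun b => (X b : Matrix (Fin N) (Fin N) ℂ)) c.src) := by
  obtain ⟨Q, hQ0, hQs⟩ := exists_linFamily (P := P) (n := Fin N)
  rw [qLin_one_eq_family Q hQ0 hQs k X]
  exact linFamily_eq_sub_comb Q hQ0 hQs Λ hΛ0 hΛs _ k c

/-- ★ **PURE GAUGES GO TO COARSE PURE GAUGES BY RESTRICTION TO THE CENTRES**: for a skew-Hermitian gauge function `φ`,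
`Q_k(1)(∂φ)(c) = φ(embIter k c₊) − φ(embIter k c₋)` ([B7] (11), linearised and iterated: UST `ChartHInv.linFamily_grad` read on the record's operator).
[cite: Balaban1985Averaging, (11) p.18; Balaban1985Variational, (4) p.278, (44) p.285] -/
theorem dIterL_one_grad {φ : Site P 0 → Matrix (Fin N) (Fin N) ℂ} (hφ : ∀ x, star (φ x) = -φ x) (k : ℕ) (c : PBond P k) :
    dIterL k (1 : PBond P 0 → Matrix (Fin N) (Fin N) ℂ) (fun b => φ b.tgt - φ b.src) c = φ (embIter k c.tgt) - φ (embIter k c.src) := by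
  obtain ⟨Q, hQ0, hQs⟩ := exists_linFamily (P := P) (n := Fin N)
  have hY : ∀ b : PBond P 0, star (φ b.tgt - φ b.src) = -(φ b.tgt - φ b.src) := fun b => by rw [star_sub, hφ, hφ]; abel
  rw [(dIterL_one_apply_of_skew Q hQ0 hQs hY k).1]
  exact linFamily_grad Q hQ0 hQs φ k c

include hΛ0 hΛs in
/-- ★ **PRINT's (44) «Q_k(1) = L^kQ_k» HOLDS EXACTLY ON PLAQUETTE VARIABLES** (and on every coarse-gradient-blind reader): for skew `Y`,
`∂(Q_k(1)Y)(p) = L^k·∂(Q_kY)(p)` on every level-`k` plaquette `p` (`curl ∘ grad = 0`). [cite: Balaban1985Variational, (44) p.285; Balaban1984PropagatorsI, (1.2) p.18, (1.18) p.20] -/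
theorem curl_dIterL_one {Y : PBond P 0 → Matrix (Fin N) (Fin N) ℂ} (hY : ∀ b, star (Y b) = -Y b) (k : ℕ) (a : ℝ) (p : Plaq P k) :
    curl a (dIterL k (1 : PBond P 0 → Matrix (Fin N) (Fin N) ℂ) Y) p = (P.L ^ k : ℕ) • curl a (bondAvgIter k Y) p := by
  have hfun : (dIterL k (1 : PBond P 0 → Matrix (Fin N) (Fin N) ℂ) Y : PBond P k → Matrix (Fin N) (Fin N) ℂ) =
      fun c => (fun c => (P.L ^ k : ℕ) • bondAvgIter k Y c) c - grad 1 (Λ k Y) c := by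
    funext c
    rw [dIterL_one_eq_sub_comb Λ hΛ0 hΛs hY k c, grad, one_smul]
  rw [hfun, LatticeFieldCalculus.curl_sub, LatticeFieldCalculus.curl_grad, sub_zero]
  simp only [curl, smul_add, smul_sub, smul_comm a ((P.L ^ k : ℕ))]

end Record

/-! ## §3  THE TWO KERNELS — `ker Q_k(1)` (n07-w1∕n07-w2∕N12's chart kernel) and `ker Q_k` (= `ker Q_V`, this seat's (128) test class at one level) — ARE IN LINEAR
BIJECTION BY SKEW-HERMITIAN (𝔰𝔲(N)-VALUED) LINEARISED GAUGE TRANSFORMATIONS -/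

section Kernels

variable [NeZero N]

/-- ★★★ **FROM THE RECORD's KERNEL TO PRINT's: THE SKEW COMB GAUGE.**  Let `1 ≤ k ≤ m + K` and `Y` skew-Hermitian with `Q_k(1)Y = 0` (the record's linearised `k`-fold
constraint).  Then there is a SKEW-HERMITIAN fine gauge function `λ` VANISHING AT THE `k`-FOLD CENTRES (the Lie algebra of print's group (4)) with `Q_k(Y + ∂λ) = 0` — the
regauged field is in the kernel of the STRAIGHT average ([B5] (1.18) = lit-balaban's `QE`, §1) — and still `Q_k(1)(Y + ∂λ) = 0`; if `Y` is `𝔰𝔲(N)`-valued so is `λ`.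
(`λ` = the far-corner point masses `−L^{kd}Λ_k(Y)` of UST `Prop7CombGauge.exists_combGauge_iterLin`, re-assembled on the SKEW comb functional of §0 so that the gauge
function stays in the Lie algebra; `Q′_kλ = −Λ_k(Y)` by `siteAvgIter_cornerMass`, (1.20) `bondAvgIter_grad`.)
[cite: Balaban1985Variational, (4) p.278, (44)-(45) p.285; Balaban1984PropagatorsI, (1.18)-(1.20) p.20; Balaban1985Averaging, (11) p.18] -/
theorem exists_gauge_bondAvgIter_eq_zero_of_dIterL_one_eq_zero {k : ℕ} (hk : k ≤ P.m + P.K) (hk1 : 1 ≤ k)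
    {Y : PBond P 0 → Matrix (Fin N) (Fin N) ℂ} (hY : ∀ b, star (Y b) = -Y b)
    (h0 : ∀ c : PBond P k, dIterL k (1 : PBond P 0 → Matrix (Fin N) (Fin N) ℂ) Y c = 0) :
    ∃ lam : Site P 0 → Matrix (Fin N) (Fin N) ℂ,
      (∀ x, star (lam x) = -lam x) ∧ (∀ y : Site P k, lam (embIter k y) = 0) ∧
      (∀ c : PBond P k, bondAvgIter k (fun b => Y b + (lam b.tgt - lam b.src)) c = 0) ∧
      (∀ c : PBond P k, dIterL k (1 : PBond P 0 → Matrix (Fin N) (Fin N) ℂ) (fun b => Y b + (lam b.tgt - lam b.src)) c = 0) ∧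
      ((∀ b, Y b ∈ lieSU (Fin N)) → ∀ x, lam x ∈ lieSU (Fin N)) := by
  classical
  obtain ⟨Λ, hΛ0, hΛs⟩ := exists_combFamily (P := P) (n := Fin N)
  have hsites : P.sitesPerDir 0 = P.L ^ k * P.sitesPerDir k := B5Eq117TorusCarriers.sitesPerDir_zero_eq hk
  -- with `Q_k(1)Y = 0` the dictionary reads `L^k·Q_kY = ∂Λ_k(Y)`
  have hQ : ∀ c : PBond P k, (P.L ^ k : ℕ) • bondAvgIter k Y c = Λ k Y c.tgt - Λ k Y c.src := fun c => by
    have h := dIterL_one_eq_sub_comb Λ hΛ0 hΛs hY k c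
    rw [h0 c] at h
    exact sub_eq_zero.mp h.symm
  -- the far-corner point masses of `−L^{kd}Λ_k(Y)`
  set lam : Site P 0 → Matrix (Fin N) (Fin N) ℂ := fun x =>
    if x = Site.fibreSite 0 k (iterBlockOf k x) (fun _ => ⟨P.L ^ k - 1, Nat.sub_lt (pow_pos P.L_pos k) one_pos⟩)
      then (((P.L : ℝ) ^ P.d) ^ k) • (fun y => -Λ k Y y) (iterBlockOf k x) else 0 with hlam
  have hcentre : ∀ y : Site P k, lam (embIter k y) = 0 := fun y => by
    rw [hlam]; exact if_neg (embIter_ne_farCorner hk hk1 hsites y _)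
  have hQ' : siteAvgIter k lam = fun y => -Λ k Y y := funext fun y => siteAvgIter_cornerMass hk hsites (fun y => -Λ k Y y) y
  have hskew : ∀ x, star (lam x) = -lam x := fun x => by
    simp only [hlam]
    split_ifs
    · simp only [star_smul, star_trivial, star_neg, combFamily_skew Λ hΛ0 hΛs hY k, neg_neg, smul_neg]
    · rw [star_zero, neg_zero]
  -- `L^k·Q_k(∂λ) = −∂Λ_k(Y)`
  have hgrad : ∀ c : PBond P k, (P.L ^ k : ℕ) • bondAvgIter k (fun b : PBond P 0 => lam b.tgt - lam b.src) c = -(Λ k Y c.tgt - Λ k Y c.src) := by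
    intro c
    have hg : (fun b : PBond P 0 => lam b.tgt - lam b.src) = grad 1 lam := by funext b; rw [grad, one_smul]
    rw [hg, B5Eq120IterProof.bondAvgIter_grad k hk 1 lam, hQ', grad, ← Nat.cast_smul_eq_nsmul ℝ, smul_smul]
    have : ((P.L ^ k : ℕ) : ℝ) * (1 / (P.L : ℝ) ^ k) = 1 := by
      rw [Nat.cast_pow, mul_one_div, div_self (pow_ne_zero _ (Nat.cast_ne_zero.mpr P.L_pos.ne'))]
    rw [this, one_smul]
    abel
  have hadd : (fun b => Y b + (lam b.tgt - lam b.src)) = Y + fun b : PBond P 0 => lam b.tgt - lam b.src := rfl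
  refine ⟨lam, hskew, hcentre, fun c => ?_, fun c => ?_, fun hYsu x => ?_⟩
  · have h : (P.L ^ k : ℕ) • bondAvgIter k (fun b => Y b + (lam b.tgt - lam b.src)) c = 0 := by
      rw [hadd, bondAvgIter_add, Pi.add_apply, smul_add, hQ c, hgrad c, add_neg_cancel]
    rw [← Nat.cast_smul_eq_nsmul ℂ] at h
    exact (smul_eq_zero.mp h).resolve_left (Nat.cast_ne_zero.mpr (pow_ne_zero _ P.L_pos.ne'))
  · rw [hadd, map_add, Pi.add_apply, h0 c, dIterL_one_grad hskew k c, hcentre, hcentre, sub_self, add_zero]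
  · simp only [hlam]
    split_ifs
    · exact Submodule.smul_mem _ _ (Submodule.neg_mem _ (combFamily_mem_lieSU Λ hΛ0 hΛs hYsu k _))
    · exact Submodule.zero_mem _

/-- ★★★ **FROM PRINT's KERNEL TO THE RECORD's: THE BLOCK-CONSTANT LIFT OF THE COMB FUNCTIONAL.**  Let `k ≤ m + K` and `Z` skew-Hermitian with `Q_kZ = 0` (the
straight average ∕ lit-balaban's `QE`).  Then the SKEW-HERMITIAN fine gauge function `ν := Λ_k(Z) ∘ B^k` (the comb functional lifted as a `k`-block constant; `𝔰𝔲(N)`-valued if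
`Z` is) regauges `Z` into the kernel of the record's operator: `Q_k(1)(Z + ∂ν) = 0` (`Q_k(1)Z = −∂Λ_k(Z)` by §2, and `Q_k(1)(∂ν) = ∂(ν∘embIter k) = ∂Λ_k(Z)`).
[cite: Balaban1985Variational, (44)-(45) p.285; Balaban1984PropagatorsI, (1.18) p.20; Balaban1985Averaging, (11) p.18, (62) p.28] -/
theorem exists_gauge_dIterL_one_eq_zero_of_bondAvgIter_eq_zero {k : ℕ} (hk : k ≤ P.m + P.K)
    {Z : PBond P 0 → Matrix (Fin N) (Fin N) ℂ} (hZ : ∀ b, star (Z b) = -Z b) (h0 : ∀ c : PBond P k, bondAvgIter k Z c = 0) :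
    ∃ nu : Site P 0 → Matrix (Fin N) (Fin N) ℂ,
      (∀ x, star (nu x) = -nu x) ∧ (∀ x, nu x = nu (embIter k (iterBlockOf k x))) ∧
      (∀ c : PBond P k, dIterL k (1 : PBond P 0 → Matrix (Fin N) (Fin N) ℂ) (fun b => Z b + (nu b.tgt - nu b.src)) c = 0) ∧
      ((∀ b, Z b ∈ lieSU (Fin N)) → ∀ x, nu x ∈ lieSU (Fin N)) := by
  obtain ⟨Λ, hΛ0, hΛs⟩ := exists_combFamily (P := P) (n := Fin N)
  have hskew : ∀ x, star (Λ k Z (iterBlockOf k x)) = -Λ k Z (iterBlockOf k x) := fun x => combFamily_skew Λ hΛ0 hΛs hZ k _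
  refine ⟨fun x => Λ k Z (iterBlockOf k x), hskew, fun x => by simp only [Node00.iterBlockOf_embIter k hk], fun c => ?_,
    fun hZsu x => combFamily_mem_lieSU Λ hΛ0 hΛs hZsu k _⟩
  have hadd : (fun b => Z b + (Λ k Z (iterBlockOf k b.tgt) - Λ k Z (iterBlockOf k b.src))) =
      Z + fun b : PBond P 0 => Λ k Z (iterBlockOf k b.tgt) - Λ k Z (iterBlockOf k b.src) := rfl
  rw [hadd, map_add, Pi.add_apply, dIterL_one_eq_sub_comb Λ hΛ0 hΛs hZ k c, h0 c, smul_zero, zero_sub,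
    dIterL_one_grad (φ := fun x => Λ k Z (iterBlockOf k x)) hskew k c]
  simp only [Node00.iterBlockOf_embIter k hk]
  abel

/-- ★★ **GAUGE-BLIND READERS CANNOT TELL THE TWO KERNELS APART.**  An additive functional `ℓ` of skew fine fields that kills every skew-Hermitian pure gauge `∂μ` annihilates
the skew kernel of the record's `Q_k(1)` iff it annihilates the skew kernel of print's `Q_k` (`1 ≤ k ≤ m + K`).
[cite: Balaban1985Variational, (4) p.278, (44)-(45) p.285; Balaban1984PropagatorsI, (1.18) p.20] -/
theorem annihilates_ker_dIterL_one_iff {k : ℕ} (hk : k ≤ P.m + P.K) (hk1 : 1 ≤ k) {W : Type*} [AddCommGroup W]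
    (ℓ : (PBond P 0 → Matrix (Fin N) (Fin N) ℂ) →+ W)
    (hℓ : ∀ μ : Site P 0 → Matrix (Fin N) (Fin N) ℂ, (∀ x, star (μ x) = -μ x) → ℓ (fun b => μ b.tgt - μ b.src) = 0) :
    (∀ Y : PBond P 0 → Matrix (Fin N) (Fin N) ℂ, (∀ b, star (Y b) = -Y b) →
        (∀ c : PBond P k, dIterL k (1 : PBond P 0 → Matrix (Fin N) (Fin N) ℂ) Y c = 0) → ℓ Y = 0) ↔
      (∀ Z : PBond P 0 → Matrix (Fin N) (Fin N) ℂ, (∀ b, star (Z b) = -Z b) → (∀ c : PBond P k, bondAvgIter k Z c = 0) → ℓ Z = 0) := by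
  constructor
  · intro h Z hZ hQ
    obtain ⟨nu, hnu, -, hker, -⟩ := exists_gauge_dIterL_one_eq_zero_of_bondAvgIter_eq_zero hk hZ hQ
    have hZ' : ∀ b : PBond P 0, star (Z b + (nu b.tgt - nu b.src)) = -(Z b + (nu b.tgt - nu b.src)) := fun b => by
      rw [star_add, star_sub, hZ, hnu, hnu]; abel
    have h1 := h _ hZ' hker
    rw [show (fun b => Z b + (nu b.tgt - nu b.src)) = Z + fun b : PBond P 0 => nu b.tgt - nu b.src from rfl, map_add, hℓ nu hnu,
      add_zero] at h1
    exact h1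
  · intro h Y hY hQ
    obtain ⟨lam, hlam, -, hker, -, -⟩ := exists_gauge_bondAvgIter_eq_zero_of_dIterL_one_eq_zero hk hk1 hY hQ
    have hY' : ∀ b : PBond P 0, star (Y b + (lam b.tgt - lam b.src)) = -(Y b + (lam b.tgt - lam b.src)) := fun b => by
      rw [star_add, star_sub, hY, hlam, hlam]; abel
    have h1 := h _ hY' hker
    rw [show (fun b => Y b + (lam b.tgt - lam b.src)) = Y + fun b : PBond P 0 => lam b.tgt - lam b.src from rfl, map_add, hℓ lam hlam,
      add_zero] at h1
    exact h1

end Kernels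

end Summit.QuantumFields.YangMills.Theorems.K0Stub1FlatAveragingDictionary

end
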